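import Mathlib
import Literature.Computability.AlgebraicComplexity.HessianAtOrigin
import Summits.ValiantsHypothesis.ValiantsHypothesis.Theorems.GrenetZeonTwoDimCoefficientsScalingClosureRank
import Summits.ValiantsHypothesis.ValiantsHypothesis.Theorems.GrenetZeonTwoDimCoefficientsScalingAlgebra

/-!
# Crux `GrenetZeon.TwoDimCoefficients` (stmt-ValiantsHypothesis-8062), stub `stub_dualUnipotent`:
# scaling-closure — the limit step needs the slice bound only at SMOOTH zeros (iterable form)

After one degeneration the information available on the special fibre `Φ` is a Hessian-rank bound at its
SMOOTH zeros only (✓ `rank_hess0_shadow_le`).  To degenerate AGAIN (e.g. along a one-parameter subgroup of the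
torus stabiliser of `per_n`, which kills every companion monomial of positive weight — memo SIXTEENTH-HAND.md)
the limit step must therefore accept a slice bound that is itself restricted to smooth zeros.  This file
provides that ITERABLE form: smoothness in the `z_i`-direction is an open condition and is transported along
the selected curve together with the rank condition.

* ★ `rank_hess0_shadow_le_smooth` — `P ∈ ℂ[z, δ]` with special fibre `Φ`; if the `z`-Hessian of `P` has rank
  `≤ r` at every zero `x` of `P` off `δ = 0` AT WHICH `∂_{z_i} P(x) ≠ 0`, then `rank Hess Φ(z₀) ≤ r` at every
  zero `z₀` of `Φ` with `∂_i Φ(z₀) ≠ 0`.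

HONEST FRAMING: plumbing for iterated degenerations; nothing about the permanent, the stub, the crux or
`VP ≠ VNP` is proved here.

References: T. Mignon, N. Ressayre, Int. Math. Res. Not. 2004:79, Thm. 1.1.
-/

-- single-conjunct layout `Summits/ValiantsHypothesis/ValiantsHypothesis`: the duplicated namespace
-- component is mandated by the tree.
set_option linter.dupNamespace false
set_option autoImplicit false

noncomputable section

namespace Summit.ValiantsHypothesis.ValiantsHypothesis.Theorems.GrenetZeonTwoDimCoefficients.ScalingClosure

open MvPolynomial Matrix Filter Topology
open Literature.Computability.AlgebraicComplexity

variable {σ : Type*} [Fintype σ] [DecidableEq σ]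

/-- ★ **Limit step with a smooth-zero slice bound (iterable form).**  Let `P ∈ ℂ[z_σ, δ]` have special
fibre `P(z, 0) = Φ(z)` and fix a coordinate `i`.  Suppose the `z`-Hessian of `P` has rank `≤ r` at every
zero `x` of `P` with `δ ≠ 0` and `∂_{z_i} P(x) ≠ 0`.  Then `rank Hess Φ(z₀) ≤ r` at every zero `z₀` of `Φ`
with `∂_i Φ(z₀) ≠ 0`.  (Both `rank ≥ r + 1` and `∂_{z_i} P ≠ 0` are open; curve selection
✓ `exists_mem_nhds_off_coord`.) [folklore] -/
theorem rank_hess0_shadow_le_smooth (P : MvPolynomial (Option σ) ℂ) (Φ : MvPolynomial σ ℂ) (r : ℕ)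
    (i : σ) (h0 : ∀ z : σ → ℂ, eval (fun o : Option σ => o.elim (0 : ℂ) z) P = eval z Φ)
    (hMR : ∀ x : Option σ → ℂ, x none ≠ 0 → eval x P = 0 → eval x (pderiv (some i) P) ≠ 0 →
      ((Matrix.of fun s t : σ => pderiv (some s) (pderiv (some t) P)).map (eval x)).rank ≤ r)
    (z₀ : σ → ℂ) (hz : eval z₀ Φ = 0) (hi : eval z₀ (pderiv i Φ) ≠ 0) :
    (hess0 (transl z₀ Φ)).rank ≤ r := by
  by_contra hlt
  rw [not_le] at hlt
  set a : Option σ → ℂ := fun o => o.elim (0 : ℂ) z₀ with ha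
  set H : Matrix σ σ (MvPolynomial (Option σ) ℂ) :=
    Matrix.of fun s t : σ => pderiv (some s) (pderiv (some t) P) with hH
  have hHa : H.map (eval a) = hess0 (transl z₀ Φ) := hessian_slice P Φ 0 h0 z₀
  have hPa : eval a P = 0 := by rw [ha, h0, hz]
  have hPj : eval a (pderiv (some i) P) ≠ 0 := by
    rw [ha, eval_pderiv_some_slice P Φ 0 h0 z₀ i]
    exact hi
  -- the two open conditions near `a`
  have hS1 : {x : Option σ → ℂ | r + 1 ≤ (H.map (eval x)).rank} ∈ 𝓝 a :=
    setOf_le_rank_mem_nhds (fun x => H.map (eval x)) (continuous_matrix_map_eval H)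
      (by rw [hHa]; exact hlt)
  have hS2 : {x : Option σ → ℂ | eval x (pderiv (some i) P) ≠ 0} ∈ 𝓝 a :=
    (continuous_eval (pderiv (some i) P)).continuousAt.preimage_mem_nhds (isOpen_ne.mem_nhds hPj)
  -- curve selection for `F = eval · P`
  have hF : HasStrictFDerivAt (fun x : Option σ → ℂ => eval x P)
      (fderiv ℂ (fun x : Option σ → ℂ => eval x P) a) a :=
    ((AnalyticOnNhd.eval_mvPolynomial P) a (Set.mem_univ a)).hasStrictFDerivAt
  have hFj : fderiv ℂ (fun x : Option σ → ℂ => eval x P) a (Pi.single (some i) 1) ≠ 0 := by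
    rwa [fderiv_eval_apply_single]
  obtain ⟨x, ⟨hx1, hx2⟩, hxδ, hxP⟩ := exists_mem_nhds_off_coord (fun x : Option σ → ℂ => eval x P) hF
    (i₀ := none) (j := some i) (Option.some_ne_none i) hFj (Filter.inter_mem hS1 hS2)
  have hx0 : x none ≠ 0 := by simpa [ha] using hxδ
  have hxP0 : eval x P = 0 := hxP.trans hPa
  have := hMR x hx0 hxP0 hx2
  exact absurd (le_trans hx1 this) (by omega)

/-- **Corollary (stability of the smooth-zero bound under degeneration).**  If every slice `δ = δ₀ ≠ 0` of
`P` satisfies "rank `Hess ≤ r` at all zeros with `∂_{z_i} ≠ 0`" for EVERY `i`, then the special fibre satisfies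
the same property: at every zero `z₀` of `Φ` with `∇Φ(z₀) ≠ 0`, `rank Hess Φ(z₀) ≤ r`. [folklore] -/
theorem smoothZeroBound_specialFibre (P : MvPolynomial (Option σ) ℂ) (Φ : MvPolynomial σ ℂ) (r : ℕ)
    (h0 : ∀ z : σ → ℂ, eval (fun o : Option σ => o.elim (0 : ℂ) z) P = eval z Φ)
    (hMR : ∀ x : Option σ → ℂ, x none ≠ 0 → eval x P = 0 → (∃ i : σ, eval x (pderiv (some i) P) ≠ 0) →
      ((Matrix.of fun s t : σ => pderiv (some s) (pderiv (some t) P)).map (eval x)).rank ≤ r)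
    (z₀ : σ → ℂ) (hz : eval z₀ Φ = 0) (hgrad : ∃ i : σ, eval z₀ (pderiv i Φ) ≠ 0) :
    (hess0 (transl z₀ Φ)).rank ≤ r := by
  obtain ⟨i, hi⟩ := hgrad
  exact rank_hess0_shadow_le_smooth P Φ r i h0 (fun x hx hP hPi => hMR x hx hP ⟨i, hPi⟩) z₀ hz hi

end Summit.ValiantsHypothesis.ValiantsHypothesis.Theorems.GrenetZeonTwoDimCoefficients.ScalingClosure

end
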